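import Summits.BirchSwinnertonDyer.BirchSwinnertonDyer.Theorems.PrintCf2RubinValueTwoBrickCD4ChiValueRelation
import HarnessLib

/-!
# Brick (c) at `p = 2`, module M-TOP of the second pair, (L3) input at the level of DOUBLE FAMILIES: one lift `g̃` of `(𝔤, ·/K)` for ALL layers
# `K(𝔪_i v^{k+1})`, and the value relations `(g̃·t) • y_𝔠 · (t • y_𝔤)^{N𝔠} = t • y_{𝔠𝔤}` on every layer at once

Cell `bsd-print-cf2`, width seat `bsd-line-cf2c-w7` g27, route C `PrintCf2RubinValueTwo`, crux of record stmt-BirchSwinnertonDyer-24033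
`TwoVariableMainConjAtSplitTwoQuad` (23720 nominal), BRICK §4(c); memo v6 `Cruxes/TwoVariableMainConjAtSplitTwoQuad/BRICK-C-D4CHI-g27.md` §6.
OUTPUT SHAPE = the hypotheses `hval₁` / `hval₂` of `…BrickCD4ChiMultiplierOnGenerators.sub_mul_phi_averaged_eq_sub_mul_phi_averaged` for double families
`x_𝔞, x_𝔠, x_{𝔞𝔠} : ∀ i k, K(𝔪_i v^{k+1})` of Θ(1)-values (`IsThetaValueOne`), GIVEN de Shalit II.2.4 (ii) (`DeShalit1987.prop24_ii_galoisAction`, hypothesis).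

* ★ `exists_forall₂_absRestrictNormalHom_eq_artinSymbol` — ONE `g̃ ∈ Γ_K` with `g̃|_{K(𝔪_i v^{k+1})} = (𝔤, K(𝔪_i v^{k+1})/K)` for all `i, k` (Neukirch VI (7.1)).
* ★★★ `exists_lift_forall_value_relation` — `∃ g̃, ∀ t i k, (g̃t) • y_𝔠 · (t • y_𝔞)^{N𝔠} = t • y_{𝔞𝔠}` (all layers, all `t ∈ Γ_K`).
THEOREMS ONLY (0 sorry, no new definitions); CONDITIONAL on the published named fact `DeShalit1987.prop24_ii_galoisAction` (hypothesis, never asserted).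
BSD is not proved by any of this; nothing here closes 24033 or 27037.

## References
* [deShalit1987] E. de Shalit, *Iwasawa theory of elliptic curves with complex multiplication* (1987), II §2.4 Proposition (ii), §4.12 (p. 66).
* [NeukirchANT1999] J. Neukirch, *Algebraic Number Theory* (1999), Ch. VI §7 Thm. (7.1).
-/

noncomputable section

set_option linter.dupNamespace false
set_option autoImplicit false

open scoped NumberField nonZeroDivisors

namespace Summit.BirchSwinnertonDyer.BirchSwinnertonDyer.Theorems.PrintCf2.BrickCD4Chi

open Field IsDedekindDomain IsDedekindDomain.HeightOneSpectrum ValuativeRel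
open Literature.NumberTheory.NumberFields
open Literature.NumberTheory.GaloisRepresentations Literature.NumberTheory.GaloisRepresentations.IsNonarchimedeanLocalField
open Literature.NumberTheory.EllipticCurves
open Literature.NumberTheory.ComplexMultiplication.EllipticUnits
open Literature.NumberTheory.LFunctions.AbelianDensity (artinSymbol)
open Summit.BirchSwinnertonDyer.BirchSwinnertonDyer.Theorems.PrintCf2.LeopoldtAtV
open Summit.BirchSwinnertonDyer.BirchSwinnertonDyer.Theorems.PrintCf2.EllipticUnitsLocal

variable {K : Type} [Field K] [NumberField K] {v : HeightOneSpectrum (𝓞 K)} {𝔪 : ℕ → Ideal (𝓞 K)}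

/-- ★ **ONE lift of the Artin symbol of `𝔤` for ALL layers `K(𝔪_i v^{k+1})`** (`𝔤 ≠ 0` prime to every `𝔪_i v`): a lift of the idelic Artin symbol.
[cite: NeukirchANT1999, Ch. VI §7 Thm. (7.1)] [cite: deShalit1987, II §4.12 (p. 66)] -/
theorem exists_forall₂_absRestrictNormalHom_eq_artinSymbol (h𝔪0 : ∀ i, 𝔪 i ≠ ⊥) {𝔤 : Ideal (𝓞 K)} (h𝔤0 : 𝔤 ≠ ⊥)
    (h𝔤c : ∀ i, IsCoprime 𝔤 (𝔪 i * v.asIdeal)) :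
    ∃ g : absoluteGaloisGroup K, ∀ i k : ℕ,
      absRestrictNormalHom (rayClassField K (𝔪 i * v.asIdeal ^ (k + 1))) g =
        artinSymbol (galFrob K (rayClassField K (𝔪 i * v.asIdeal ^ (k + 1)))) 𝔤 := by
  obtain ⟨g, hg⟩ := exists_forall_absRestrictNormalHom_eq_artinHom (K := K)
    (Units.mk0 (𝔤 : FractionalIdeal (𝓞 K)⁰ K) (FractionalIdeal.coeIdeal_ne_zero.mpr h𝔤0))
  refine ⟨g, fun i k ↦ ?_⟩
  rw [hg _ (mul_pow_succ_ne_bot (h𝔪0 i) v k)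
    (unitsMk0_coeIdeal_mem_idealsPrimeTo (mul_pow_succ_ne_bot (h𝔪0 i) v k) h𝔤0 (isCoprime_mul_pow_succ (h𝔤c i) k)),
    artinHom_unitsMk0_coeIdeal _ h𝔤0]

/-- ★★★ **THE VALUE RELATIONS ON ALL LAYERS WITH ONE LIFT.**  For `K` imaginary quadratic, moduli `𝔪_i ≠ 0, 𝒪_K`-proper with `v`, ideals `𝔞, 𝔠 ≠ 0` prime to
every `𝔪_i v`, and double families of Θ(1)-values `y_𝔞, y_𝔠, y_{𝔞𝔠}` on the layers `K(𝔪_i v^{k+1})`: there is `g̃ ∈ Γ_K` (a lift of the Artin symbols of `𝔞`)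
with **`(g̃·t) • y_𝔠(i,k) · (t • y_𝔞(i,k))^{N𝔠} = t • y_{𝔞𝔠}(i,k)` for all `t ∈ Γ_K` and all `i, k`** — GIVEN II.2.4 (ii).
[cite: deShalit1987, II §2.4 Proposition (ii), §4.12 (p. 66)] [cite: NeukirchANT1999, Ch. VI §7 Thm. (7.1)] -/
theorem exists_lift_forall_value_relation (h24ii : DeShalit1987.prop24_ii_galoisAction) (hK : IsImaginaryQuadratic K) (ι : K →+* ℂ)
    (h𝔪0 : ∀ i, 𝔪 i ≠ ⊥) (h𝔪1 : ∀ i k, 𝔪 i * v.asIdeal ^ (k + 1) ≠ ⊤)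
    {𝔞 𝔠 : Ideal (𝓞 K)} (h𝔞0 : 𝔞 ≠ ⊥) (h𝔞c : ∀ i, IsCoprime 𝔞 (𝔪 i * v.asIdeal)) (h𝔠0 : 𝔠 ≠ ⊥) (h𝔠c : ∀ i, IsCoprime 𝔠 (𝔪 i * v.asIdeal))
    (ya yc yac : ∀ i k : ℕ, rayClassField K (𝔪 i * v.asIdeal ^ (k + 1)))
    (hya : ∀ i k, IsThetaValueOne ι (𝔪 i * v.asIdeal ^ (k + 1)) 𝔞 (algClosureEmb ι ((ya i k : rayClassField K (𝔪 i * v.asIdeal ^ (k + 1))) : AlgebraicClosure K)))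
    (hyc : ∀ i k, IsThetaValueOne ι (𝔪 i * v.asIdeal ^ (k + 1)) 𝔠 (algClosureEmb ι ((yc i k : rayClassField K (𝔪 i * v.asIdeal ^ (k + 1))) : AlgebraicClosure K)))
    (hyac : ∀ i k, IsThetaValueOne ι (𝔪 i * v.asIdeal ^ (k + 1)) (𝔞 * 𝔠)
      (algClosureEmb ι ((yac i k : rayClassField K (𝔪 i * v.asIdeal ^ (k + 1))) : AlgebraicClosure K))) :
    ∃ g : absoluteGaloisGroup K, ∀ (t : absoluteGaloisGroup K) (i k : ℕ),
      (g * t) • ((yc i k : rayClassField K (𝔪 i * v.asIdeal ^ (k + 1))) : AlgebraicClosure K) *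
          (t • ((ya i k : rayClassField K (𝔪 i * v.asIdeal ^ (k + 1))) : AlgebraicClosure K)) ^ Ideal.absNorm 𝔠 =
        t • ((yac i k : rayClassField K (𝔪 i * v.asIdeal ^ (k + 1))) : AlgebraicClosure K) := by
  obtain ⟨g, hg⟩ := exists_forall₂_absRestrictNormalHom_eq_artinSymbol h𝔪0 h𝔞0 h𝔞c
  refine ⟨g, fun t i k ↦ ?_⟩
  exact smul_mul_smul_pow_eq_smul_of_isThetaValueOne h24ii hK ι (mul_pow_succ_ne_bot (h𝔪0 i) v k) (h𝔪1 i k) h𝔞0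
    (isCoprime_mul_pow_succ (h𝔞c i) k) h𝔠0 (isCoprime_mul_pow_succ (h𝔠c i) k) (hya i k) (hyc i k) (hyac i k) (hg i k) t

end Summit.BirchSwinnertonDyer.BirchSwinnertonDyer.Theorems.PrintCf2.BrickCD4Chi

end
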